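import Summits.Ventures.HSemireg.WedgeHankelSubstitution

/-!
# Venture HSemireg — THE OUTER EXPANSION OF TH-7's CLASS: unrolling the recursion `w_{m+1}(q) = w_m(q)·x_m + w_m(σq)·y_m` from `M` to `N` gives
# `w_N(q) = Σ_{S ⊆ [M, N)} w_M(σ^{|S|} q) · Π_{a ∈ [M,N)} (y_a if a ∈ S else x_a)` (ordered products), so a form killing the `N − M + 1` SHIFTED SMALLER CLASSES `w_M(σ^j q)`,
# `j ≤ N − M`, kills `w_N(q)` — one half of «the kernel of the box restricted to a sub-box is the intersection of the kernels of the shifted sub-box classes»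

HONEST FRAMING. Part of the Lean index of the computation cell `pub-hsemireg` (seat p10 gen 22, Sunday typer «UNIFORM-IN-n»).
Finite-dimensional EXTERIOR ALGEBRA over a field ONLY: no variety, no cohomology theory, no sheaf, no Ext group, no semiregularity map;
nothing here says that HC / HC_CM / HC_AV holds; no Literature fact is declared or used.  Custodian versions as in `WedgeHankelSiegelIdeal` (1/3); the dictionary (`w_N(q)` = the
class of the box on `N` pairs; `w_M(σ^j q)` = the classes of the sub-box on the first `M` pairs with shifted coefficient sequences; `Sp(pairs ⊆ T)` = forms on a sub-product) is QUOTED,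
never asserted.

WHAT IS IN THE TREE.  th-7's recursion `w` (`WedgeHankelModel`: `w K N (m+1) q = w K N m q * X K N m + w K N m (shift K q) * Y K N m`), `w_add_two` (two steps, H9), the old-pair lemma
`w_mul_X_add` (gen 11); the Künneth kernel law `Kr_union_eq_krSum` for PRODUCT classes (gen 13); J6 `map_Pm_indicator_Kr_w` (`Pm(1_T)(Kr) = Kr ⊓ Sp(pairs ⊆ T)`); K25 (this seat,
`WedgeHankelPairMixingPermutation`): `dim (Kr ⊓ Sp(pairs ⊆ T))` depends on `|T|` only — its VALUE was left open (Gen 20/21 OPEN (c)).  THIS FILE (namespace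
`Summit.Ventures.HSemireg.Wedge.HankelOuter`, new; imports H1 `WedgeHankelSubstitution`):
* §352 the ordered outer monomials `((List.Ico M m).map fun a => if a ∈ S then Y a else X a).prod` (no definition: written inline): `outer_prod_succ_of_notMem` / `_insert`
  (one more pair), **`w_eq_sum_powerset_Ico`: `w K N m q = Σ_{S ∈ powerset (Ico M m)} w K N M (σ^{#S} q) * Π_{a ∈ [M,m)} (y_a if a ∈ S else x_a)`** for every `M ≤ m` (every field,
  every `q`; at `M = 0` this is th-7's unfolded formula `w_m(q) = Σ_S q_{|S|} Π (y_a / x_a)`).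
* §353 **`mul_w_eq_zero_of_forall_shift`**: if `θ ∧ w K N M (σ^j q) = 0` for every `j ≤ m − M` then `θ ∧ w K N m q = 0`; in kernel language **`mem_Kr_w_of_forall_mem_Kr_w_shift`**:
  `θ ∈ Kr(D, w_M(σ^j q), k)` for all `j ≤ N − M` ⇒ `θ ∈ Kr(D, w_N(q), k)` — the easy inclusion `⋂_j Kr(w_M(σ^j q)) ≤ Kr(w_N(q))` of the sub-box description; for `M = 0`:
  `mul_w_eq_zero_of_forall_coeff` (trivially, `q_j θ ∧ Π = 0`… recorded only as the `M = 0` instance).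
NOT typed here (next leaves): the CONVERSE for forms supported on the first `M` pairs (independence of the outer monomials over the sub-algebra of the first `M` pairs), hence
`Kr(w_N q) ⊓ Sp(pairs < M) = ⋂_{j ≤ N−M} Kr(w_M(σ^j q)) ⊓ Sp(pairs < M)` and, with K25, the value of `dim (Kr ⊓ Sp(pairs ⊆ T))` for every `|T| = M`; anything Ext-side.  New names only.
-/

open Module

namespace Summit.Ventures.HSemireg.Wedge.HankelOuter

open Summit.Ventures.HSemireg.Wedge Summit.Ventures.HSemireg.Wedge.Kunneth Summit.Ventures.HSemireg.Wedge.Hankel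
  Summit.Ventures.HSemireg.Wedge.BasisFree Summit.Ventures.HSemireg.Wedge.HankelSiegel Summit.Ventures.HSemireg.Wedge.HankelSiegelIdeal
  Summit.Ventures.HSemireg.Wedge.KunnethKernel Summit.Ventures.HSemireg.Wedge.HankelFrameChange

variable (K : Type*) [Field K] {N : ℕ}

/-! ## §352. The outer expansion -/

/-- one more pair, not chosen: the outer monomial over `[M, m+1)` of `S ⊆ [M, m)` is the one over `[M, m)` times `x_m`. -/
theorem outer_prod_succ_of_notMem {M m : ℕ} (hMm : M ≤ m) {S : Finset ℕ} (hS : m ∉ S) :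
    ((List.Ico M (m + 1)).map fun a => if a ∈ S then Y K N a else X K N a).prod = ((List.Ico M m).map fun a => if a ∈ S then Y K N a else X K N a).prod * X K N m := by
  rw [List.Ico.succ_top hMm, List.map_append, List.prod_append, List.map_singleton, List.prod_singleton, if_neg hS]

/-- one more pair, chosen: the outer monomial over `[M, m+1)` of `insert m S` is the one of `S` over `[M, m)` times `y_m` (the letters `a < m` do not see `m`). -/
theorem outer_prod_succ_insert {M m : ℕ} (hMm : M ≤ m) (S : Finset ℕ) :
    ((List.Ico M (m + 1)).map fun a => if a ∈ insert m S then Y K N a else X K N a).prod = ((List.Ico M m).map fun a => if a ∈ S then Y K N a else X K N a).prod * Y K N m := by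
  classical
  rw [List.Ico.succ_top hMm, List.map_append, List.prod_append, List.map_singleton, List.prod_singleton, if_pos (Finset.mem_insert_self m S)]
  congr 1
  refine congrArg List.prod (List.map_congr_left fun a ha => ?_)
  have ham : a ≠ m := by rw [List.Ico.mem] at ha; omega
  by_cases haS : a ∈ S
  · rw [if_pos (Finset.mem_insert_of_mem haS), if_pos haS]
  · rw [if_neg (by rw [Finset.mem_insert]; push Not; exact ⟨ham, haS⟩), if_neg haS]

/-- **THE OUTER EXPANSION: `w K N m q = Σ_{S ⊆ [M, m)} w K N M (σ^{#S} q) · Π_{a ∈ [M,m)} (y_a if a ∈ S else x_a)`** for every `M ≤ m` — th-7's recursion unrolled from `M` to `m`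
(every field, every `q`). -/
theorem w_eq_sum_powerset_Ico (M : ℕ) : ∀ m : ℕ, M ≤ m → ∀ q : ℕ → K,
    w K N m q = ∑ S ∈ (Finset.Ico M m).powerset, w K N M ((shift K)^[S.card] q) * ((List.Ico M m).map fun a => if a ∈ S then Y K N a else X K N a).prod := by
  classical
  refine Nat.le_induction (fun q => ?_) (fun m hMm ih q => ?_)
  · rw [Finset.Ico_self, Finset.powerset_empty, Finset.sum_singleton, Finset.card_empty, Function.iterate_zero, id, List.Ico.self_empty, List.map_nil, List.prod_nil, mul_one]
  · have hnot : m ∉ Finset.Ico M m := fun h => by rw [Finset.mem_Ico] at h; omega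
    rw [w, ih q, ih (shift K q), Nat.Ico_succ_right_eq_insert_Ico hMm, Finset.sum_powerset_insert hnot, Finset.sum_mul, Finset.sum_mul]
    congr 1
    · refine Finset.sum_congr rfl fun S hS => ?_
      have hSm : m ∉ S := fun h => hnot (Finset.mem_powerset.mp hS h)
      rw [mul_assoc, ← outer_prod_succ_of_notMem K hMm hSm]
    · refine Finset.sum_congr rfl fun S hS => ?_
      have hSm : m ∉ S := fun h => hnot (Finset.mem_powerset.mp hS h)
      rw [mul_assoc, ← outer_prod_succ_insert K hMm S, Finset.card_insert_of_notMem hSm, Function.iterate_succ_apply]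

/-- the full class: `w K N N q = Σ_{S ⊆ [M, N)} w K N M (σ^{#S} q) · Π (y_a / x_a)` (`M ≤ N`). -/
theorem w_top_eq_sum_powerset_Ico {M : ℕ} (hM : M ≤ N) (q : ℕ → K) :
    w K N N q = ∑ S ∈ (Finset.Ico M N).powerset, w K N M ((shift K)^[S.card] q) * ((List.Ico M N).map fun a => if a ∈ S then Y K N a else X K N a).prod :=
  w_eq_sum_powerset_Ico K M N hM q

/-! ## §353. Killing the shifted sub-box classes kills the class -/

/-- **a form `θ` with `θ ∧ w K N M (σ^j q) = 0` for every `j ≤ m − M` satisfies `θ ∧ w K N m q = 0`** (`M ≤ m`; the outer expansion, each subset `S ⊆ [M, m)` having `#S ≤ m − M`). -/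
theorem mul_w_eq_zero_of_forall_shift {M m : ℕ} (hMm : M ≤ m) (q : ℕ → K) {θ : HT K (In N)} (h : ∀ j ≤ m - M, θ * w K N M ((shift K)^[j] q) = 0) :
    θ * w K N m q = 0 := by
  rw [w_eq_sum_powerset_Ico K M m hMm q, Finset.mul_sum]
  refine Finset.sum_eq_zero fun S hS => ?_
  have hcard : S.card ≤ m - M := by
    have h1 := Finset.card_le_card (Finset.mem_powerset.mp hS)
    rwa [Nat.card_Ico] at h1
  rw [← mul_assoc, h S.card hcard, zero_mul]

/-- **KERNEL FORM: `θ ∈ Kr(D, w_M(σ^j q), k)` for all `j ≤ N − M` ⇒ `θ ∈ Kr(D, w_N(q), k)`** (`M ≤ N`, any block `D`, any degree `k`) — the kernels of the `N − M + 1` shifted classes of the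
sub-box on the first `M` pairs lie in the kernel of the class of the box. -/
theorem mem_Kr_w_of_forall_mem_Kr_w_shift {M : ℕ} (hM : M ≤ N) (D : Finset (In N)) (k : ℕ) (q : ℕ → K) {θ : HT K (In N)} (hθ : θ ∈ Hom K (In N) D k)
    (h : ∀ j ≤ N - M, θ ∈ Kr K D (w K N M ((shift K)^[j] q)) k) : θ ∈ Kr K D (w K N N q) k :=
  mem_Kr.mpr ⟨hθ, mul_w_eq_zero_of_forall_shift K hM q fun j hj => (mem_Kr.mp (h j hj)).2⟩

/-- submodule form: **`Hom(D, k) ⊓ ⨅_{j ≤ N − M} Kr(D, w_M(σ^j q), k) ≤ Kr(D, w_N(q), k)`.** -/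
theorem iInf_Kr_w_shift_le_Kr_w {M : ℕ} (hM : M ≤ N) (D : Finset (In N)) (k : ℕ) (q : ℕ → K) :
    Hom K (In N) D k ⊓ (⨅ j : Fin (N - M + 1), Kr K D (w K N M ((shift K)^[(j : ℕ)] q)) k) ≤ Kr K D (w K N N q) k := by
  rintro θ ⟨hθ, hθ'⟩
  have h2 : ∀ j : Fin (N - M + 1), θ ∈ Kr K D (w K N M ((shift K)^[(j : ℕ)] q)) k := (Submodule.mem_iInf _).mp hθ'
  exact mem_Kr_w_of_forall_mem_Kr_w_shift K hM D k q hθ fun j hj => h2 ⟨j, by omega⟩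

end Summit.Ventures.HSemireg.Wedge.HankelOuter
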